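import Summits.ABC.IUTFork.LDHGenuineStepVSum
import Literature.IUT.LogVolume.GenuineLogThetaTowerArith
import Literature.IUT.LogVolume.GenuineSupportPrimesBound
import Literature.IUT.LogVolume.Theorem110TowerBridge
import Literature.IUT.LogVolume.DistinguishedPrimesBoundTower
import Literature.IUT.LogVolume.DifferentOrdGaloisFibre
import HarnessLib

/-!
# The fork at [IUTchIII] Corollary 3.12, L-DH level: S-b (TOWER ARITHMETIC) AT THE GENUINE DATUM —
# `HullEstimateOf T (B_III P l)` from S-a and the Prop. 1.8-type instance forms of the tower `F_tpd ⊆ F ⊆ K`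

Record-only file (D-0012) of the abc-iut cell (campaign-S seat abc-iut-S3, S-b holder for the layer-2 skeleton of the
crux `ThetaPartII`, stmt-ABC-19678 v1.2 / RESHAPE-2); TAKES NO SIDE on [IUTchIII] Cor. 3.12. Mochizuki, *Inter-universal
Teichmüller theory IV* (RIMS manuscript Apr. 2020), Thm. 1.10 proof Steps (ii) p. 24, (iii) pp. 25–26, (v) pp. 27–29.

The log-volume stub of the skeleton reads `stub_hullVolume : … → Cor22.HullVolumeAtDatum P l (B_III P l)` with
`B_III(P,l) = (l+1)/4·{(1 + 12·d_mod/l)·(log-diff + log 𝔣^{∤{2,l}}) + 2·log l + 52 + (20/3)·log(d*·l)·π(d*·l)}`,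
`d* = 2^12·3^3·5·d_mod`. Its support plan: S-a (abc-iut-c312-d1, `DHData.hullEstimateOf_ofInput_explicit`: in the
slot-constant regime, `HullEstimateOf I ((l+1)/4·{(1+4/l)·A(I) + (4/l)·B(I) + (20/3)·l*·C_N(I)})` with `A` the
`T(I)`-restricted different sum over the section's places, `B = Σ_{p∈T(I)} log p`, `C_N = #{p ∈ T(I) : p ≤ N}`, given the
(R4)-shape input) and S-b (abc-iut-S3): the TOWER ARITHMETIC of Steps (ii)–(iii). THIS FILE IS S-b AT THE DATUM:

* `PointDict.hullEstimateOf_BIII_of_towerFacts` — for a genuine datum `T` at `(P, l)` (`λ ∈ U_X`, `l ≥ 7` prime):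
  from (α) the Galois/degree facts of the tower `F_mod ⊆ F_tpd ⊆ F ⊆ K` (`F/F_tpd`, `K/F`, `K/F_mod` Galois;
  `[F:F_tpd] ∣ 2^a·3^2·5` with `a ≤ 14` — `a = 10` for print's `F_E`, `a = 13` for the cell's reading v3 `F‡ = F_tpd(E_λ[4], E_λ[15])`;
  `[K:F] ∣ l(l−1)²(l+1)`), (β) the Prop. 1.8 (vi)(vii)-type ramification facts in abc-iut-L5-t15's shapes (`hKgood`,
  `hKbad`, `hFgood`, `hFtame`: `K/F` unramified at good places `∤ l`, tamely ramified at bad ones; `F/F_tpd` unramified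
  at good places `∤ 30`, tame away from `30`), (γ) the (R4)-shape e-term input of S-a (abc-iut-S1's
  `Cor22.R4_divisionTower` / `R4_localFieldFamily_mono` output with `e_mod := d_mod`), and (δ) slot-constancy of the
  canonical `log(q_v)` over every support prime (S-a's regime): `T.HullEstimateOf (B_III P l)`. The proof is the
  composition, BY NAME, of S-a with
  `A ≤ log(𝔡^K)` (abc-iut-S1 `sum_dite_localDegree_mul_differentOrd_le_ndeg`, `K/F_mod` Galois)
  `≤ log-diff + log 𝔣 + log(2^{a+1}·3^3·5^2) + 2·log l` (abc-iut-L5-t15 `ndeg_differentDivisor_add_logCondOver_le_pow`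
  over (α)(β)) `≤ … + 2·log l + 21` (`a ≤ 14`: `log(2^15·3^3·5^2) ≤ 21`); `B ≤ 2·d_mod·(log-diff + log 𝔣) + log(2·3·5·l)` (abc-iut-S3
  `sum_log_supportPrimes_le` over abc-iut-L5-t15 `ramified_place_descends_of_not_dvd` and (β)); `C_N ≤ π(N)`; and
  abc-iut-S3's `Cor22.deltaK_le_BIII_of_le21` (Steps (ii)(iii) arithmetic = `Thm110Numerics.stepiii_final`'s).
* `PointDict.hullVolumeAtDatum_BIII_of_towerFacts` — the `∀ T` form: `Cor22.HullVolumeAtDatum P l (B_III P l)`.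

So the hypotheses (α)–(δ) ARE the named residual inputs of `stub_hullVolume`'s support plan at a point: (α)(β) = the
instance forms of [IUTchIV] Prop. 1.8 for the datum's tower (abc-iut-S-d1 `ThetaTowerRamification` / `…Unramified` /
`Theorem110GenuineStepII(Datum)`; under reading v3 for `F ⊆ F‡`), (γ) = abc-iut-S1's e-term (`R4_divisionTower`, modulo
the presentation of `K` in `F(E_F[l])`), (δ) = the slot-constant regime of S-a (the open remainder of `stub_hullVolume`
= VERDICT RISK 7's locus otherwise). [cite: Mochizuki2012, IUTchIV Thm. 1.10 proof Steps (ii)–(v) p. 24–29]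
[claim: Mochizuki2012, status: disputed] for every IUT quotation. Nothing here asserts (α)–(δ) or Cor. 3.12 for any point.
-/

noncomputable section

namespace Summit.ABC.IUTFork

open Literature.IUT.HodgeTheaters Literature.IUT.LogVolume NumberField IsDedekindDomain
open Literature.NumberTheory.DiophantineGeometry.GenEll
open scoped Nat.Prime

namespace PointDict

variable {P : NFPoint} {l : ℕ}

/-- `log((2^12·3^3·5·d)·l) ≥ 0` for `d, l ≥ 1`. [cite: Mochizuki2012, IUTchIV Thm. 1.10 p. 22] -/
private theorem log_dstar_mul_nonneg {d l : ℕ} (hd : 1 ≤ d) (hl : 1 ≤ l) :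
    0 ≤ Real.log (((2 ^ 12 * 3 ^ 3 * 5 * d : ℕ) : ℝ) * l) := by
  apply Real.log_nonneg
  have h1 : (1 : ℝ) ≤ ((2 ^ 12 * 3 ^ 3 * 5 * d : ℕ) : ℝ) := by exact_mod_cast (by nlinarith : 1 ≤ 2 ^ 12 * 3 ^ 3 * 5 * d)
  have h2 : (1 : ℝ) ≤ (l : ℝ) := by exact_mod_cast hl
  nlinarith

/-- `log(2^{a+1}·3^3·5^2) ≤ 21` for `a ≤ 14` (print's `a = 10`; the cell's reading v3 needs `a ≤ 13`:
`F‡ = F_tpd(E_λ[4], E_λ[15])`, `[F‡:F_tpd] ∣ 2^13·3^2·5`), via (E6)-type bounds `log 2 ≤ 0.6932`, `log 3, log 5 ≤ 2`.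
[cite: Mochizuki2012, IUTchIV Thm. 1.10 proof Step (ii) p. 24] -/
private theorem log_two_pow_succ_le_of_le_fourteen {a : ℕ} (ha : a ≤ 14) :
    Real.log (2 ^ (a + 1) * 3 ^ 3 * 5 ^ 2) ≤ 21 := by
  have h15 : Real.log (2 ^ 15 * 3 ^ 3 * 5 ^ 2) ≤ 21 := by
    have h2 : Real.log 2 ≤ 0.6931471808 := Real.log_two_lt_d9.le
    have h3 : Real.log 3 ≤ 2 := by
      have := Real.log_le_sub_one_of_pos (show (0 : ℝ) < 3 by norm_num); linarith
    have he := Real.exp_one_gt_d9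
    have h5' : (5 : ℝ) ≤ Real.exp 2 := by
      have : Real.exp 2 = Real.exp 1 * Real.exp 1 := by rw [← Real.exp_add]; norm_num
      rw [this]; nlinarith
    have h5 : Real.log 5 ≤ 2 := by
      calc Real.log 5 ≤ Real.log (Real.exp 2) := Real.log_le_log (by norm_num) h5'
        _ = 2 := Real.log_exp 2
    rw [Real.log_mul (by norm_num) (by norm_num), Real.log_mul (by norm_num) (by norm_num),
      Real.log_pow, Real.log_pow, Real.log_pow]
    push_cast
    linarith
  refine le_trans (Real.log_le_log (by positivity) ?_) h15
  have h : (2 : ℝ) ^ (a + 1) ≤ 2 ^ 15 := pow_le_pow_right₀ (by norm_num) (by omega)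
  nlinarith

/-- **S-b AT THE GENUINE DATUM: `T.HullEstimateOf (B_III P l)` from S-a and the tower facts.** For `λ ∈ U_X`
(minimally presented), a prime `l ≥ 7`, a genuine Θ-volume datum `T` at `(P, l)`, and — for the tower
`F_mod = ℚ(j(E_F)) ⊆ F_tpd ⊆ F ⊆ K` of `T` — the hypothesis `H` bundling: (α) `F/F_tpd`, `K/F`, `K/F_mod` Galois,
`[F:F_tpd] ∣ 2^a·3^2·5` for some `a ≤ 14`, `[K:F] ∣ l(l−1)²(l+1)`; (β) `hKgood`/`hKbad`/`hFgood`/`hFtame` ([IUTchIV]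
Prop. 1.8 (vi)(vii) instance shapes, the place of `F_tpd` under a place of `K` written `finBelow F_tpd F (finBelow F K ·)`);
(γ) the (R4)-shape e-term input with `e*_mod := d*_mod` (p. 22 "`e_mod ≤ d_mod`"); (δ) slot-constancy of the canonical
`log(q_v)` over every support prime: `T.HullEstimateOf (B_III P l)` (exact registered bytes).
[cite: Mochizuki2012, IUTchIV Thm. 1.10 proof Steps (ii)–(v) p. 24–29] [claim: Mochizuki2012, status: disputed] -/
theorem hullEstimateOf_BIII_of_towerFacts (T : Cor22.ThetaVolumeDatumAt P l) (hP : P ∈ UP) (hl : l.Prime) (h7 : 7 ≤ l)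
    (H : letI := T.instFieldF; letI := T.instNumberFieldF; letI := T.instAlgebraF; letI := T.instFieldK
      letI := T.instNumberFieldK; letI := T.instAlgebraK; letI := T.instFieldFbar; letI := T.instAlgebraFbar
      letI := T.instAlgebraKFbar; letI := T.instIsElliptic
      IsGalois P.F T.F ∧ IsGalois T.F T.K ∧ IsGalois (fieldOfModuli T.E) T.K ∧
      (∃ a : ℕ, a ≤ 14 ∧ Module.finrank P.F T.F ∣ 2 ^ a * 3 ^ 2 * 5) ∧
      Module.finrank T.F T.K ∣ l * (l - 1) ^ 2 * (l + 1) ∧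
      (∀ u : HeightOneSpectrum (𝓞 T.K), residueChar T.K u ≠ l →
        finBelow P.F T.F (finBelow T.F T.K u) ∉ Cor22.badPlaces P → u.asIdeal.ramificationIdx (𝓞 T.F) = 1) ∧
      (∀ u : HeightOneSpectrum (𝓞 T.K), residueChar T.K u ≠ l →
        finBelow P.F T.F (finBelow T.F T.K u) ∈ Cor22.badPlaces P →
          ¬ residueChar T.K u ∣ u.asIdeal.ramificationIdx (𝓞 T.F)) ∧
      (∀ w : HeightOneSpectrum (𝓞 T.F), residueChar T.F w ∉ ({2, 3, 5} : Finset ℕ) →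
        finBelow P.F T.F w ∉ Cor22.badPlaces P → w.asIdeal.ramificationIdx (𝓞 P.F) = 1) ∧
      (∀ w : HeightOneSpectrum (𝓞 T.F), residueChar T.F w ∉ ({2, 3, 5} : Finset ℕ) →
        ¬ residueChar T.F w ∣ w.asIdeal.ramificationIdx (𝓞 P.F)) ∧
      (∀ (p : ℕ) [hp : Fact p.Prime], p ∈ T.I.supportPrimes → ∀ v : placesOver (fieldOfModuli T.E) p,
        p - 2 < absRamificationIdx p ((T.I.σ.localFieldFamily p hp.out).k v) →
          p ≤ 2 ^ 12 * 3 ^ 3 * 5 * Cor22.dmod P * l ∧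
            3 + Real.log (absRamificationIdx p ((T.I.σ.localFieldFamily p hp.out).k v)) ≤
              4 * Real.log (((2 ^ 12 * 3 ^ 3 * 5 * Cor22.dmod P : ℕ) : ℝ) * l)) ∧
      (∀ p ∈ T.I.supportPrimes, ∀ v w : placesOver (fieldOfModuli T.E) p,
        (DHData.ofInput T.I).logQloc p v = (DHData.ofInput T.I).logQloc p w)) :
    T.HullEstimateOf (((l : ℝ) + 1) / 4 * ((1 + 12 * (Cor22.dmod P : ℝ) / l) * (P.logDiff + Cor22.logCondAvoid P {2, l})
      + 2 * Real.log l + 52 + 20 / 3 * Real.log (((2 ^ 12 * 3 ^ 3 * 5 * Cor22.dmod P : ℕ) : ℝ) * (l : ℝ))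
        * (Nat.primeCounting (2 ^ 12 * 3 ^ 3 * 5 * Cor22.dmod P * l) : ℝ))) := by
  classical
  letI := T.instFieldF; letI := T.instNumberFieldF; letI := T.instAlgebraF; letI := T.instFieldK
  letI := T.instNumberFieldK; letI := T.instAlgebraK; letI := T.instFieldFbar; letI := T.instAlgebraFbar
  letI := T.instAlgebraKFbar; letI := T.instIsElliptic
  obtain ⟨hGalF, hGalK, hGalMod, ⟨a, ha, hdegF⟩, hdegK, hKgood, hKbad, hFgood, hFtame, hR4, hconst⟩ := H
  haveI := hGalF; haveI := hGalK; haveI := hGalMod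
  -- the composite algebra `F_tpd → F → K`
  letI : Algebra P.F T.K := ((algebraMap T.F T.K).comp (algebraMap P.F T.F)).toAlgebra
  haveI : IsScalarTower P.F T.F T.K := IsScalarTower.of_algebraMap_eq fun _ => rfl
  have hfb : ∀ u : HeightOneSpectrum (𝓞 T.K), finBelow P.F T.F (finBelow T.F T.K u) = finBelow P.F T.K u :=
    fun u => finBelow_finBelow P.F T.F T.K u
  have h5 : 5 ≤ l := by omega
  have hl1 : 1 ≤ l := by omega
  have hd : 1 ≤ Cor22.dmod P := Cor22.dmod_pos P
  have hXl : ((T.I.X.l : ℕ) : ℝ) = (l : ℝ) := by exact_mod_cast T.isVolumeInputOf.l_eq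
  -- S-a (abc-iut-c312-d1): the hull estimate with the explicit Step (v) constant, `N = d*·l`, `l* = log(d*·l)`
  have hlmod := log_dstar_mul_nonneg hd hl1
  have h0 := DHData.hullEstimateOf_ofInput_explicit T.I (2 ^ 12 * 3 ^ 3 * 5 * Cor22.dmod P * l) hlmod hR4 hconst
  -- (ii-K) for `A`: abc-iut-S1 (section sum ≤ `log 𝔡^K`) then abc-iut-L5-t15 (tower bound), then `a ≤ 14`
  have hprimes : ∀ p ∈ T.I.supportPrimes, p.Prime := fun p hp => T.I.prime_of_mem_supportPrimes hp
  have hA1 := sum_dite_localDegree_mul_differentOrd_le_ndeg (fieldOfModuli T.E) T.K T.I.σ T.I.supportPrimes hprimes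
  have hA2 := Cor22.ndeg_differentDivisor_add_logCondOver_le_pow P hl h7 a T.F T.K hdegF hdegK
    (fun u hu hb => hKgood u hu (by rwa [hfb u])) (fun u hu hb => hKbad u hu (by rwa [hfb u])) hFgood hFtame
  have hA3 := Cor22.logCondOver_nonneg P {2, l} T.K
  have hA4 := log_two_pow_succ_le_of_le_fourteen ha
  have hA : (∑ p ∈ T.I.supportPrimes, if hp : p.Prime then haveI : Fact p.Prime := ⟨hp⟩
        (∑ v : placesOver (fieldOfModuli T.E) p, (localDegree (fieldOfModuli T.E) v.1 : ℝ) *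
          differentOrd p ((T.I.σ.localFieldFamily p hp).k v)) / Module.finrank ℚ (fieldOfModuli T.E) * Real.log p
        else 0) ≤ P.logDiff + Cor22.logCondAvoid P {2, l} + 2 * Real.log l + 21 := by
    linarith
  -- (iii) for `B`: abc-iut-S3 `sum_log_supportPrimes_le` over the (D0)-descent (abc-iut-L5-t15) from `hKgood`/`hFgood`
  have hS : ∀ p ∈ ({2, l} : Finset ℕ), p.Prime := by
    intro p hp
    simp only [Finset.mem_insert, Finset.mem_singleton] at hp
    rcases hp with rfl | rfl
    · exact Nat.prime_two
    · exact hl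
  have avoid_of_bad : ∀ v : HeightOneSpectrum (𝓞 P.F), v ∈ Cor22.badPlaces P → residueChar P.F v ≠ 2 →
      residueChar P.F v ≠ l → v ∈ Cor22.badPlacesAvoid P {2, l} := by
    intro v hv h2 hl'
    refine Cor22.mem_badPlacesAvoid_of_residueChar_notMem hS hv ?_
    simp only [Finset.mem_insert, Finset.mem_singleton, not_or]
    exact ⟨h2, hl'⟩
  have hKunr : ∀ u : HeightOneSpectrum (𝓞 T.K), residueChar T.K u ∉ ({2, 3, 5, l} : Finset ℕ) →
      finBelow P.F T.K u ∉ Cor22.badPlacesAvoid P {2, l} → u.asIdeal.ramificationIdx (𝓞 T.F) = 1 := by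
    intro u hp hSu
    simp only [Finset.mem_insert, Finset.mem_singleton, not_or] at hp
    refine hKgood u hp.2.2.2 fun hb => hSu ?_
    rw [hfb u] at hb
    have hres : residueChar P.F (finBelow P.F T.K u) = residueChar T.K u := residueChar_finBelow (F := P.F) u
    exact avoid_of_bad _ hb (by rw [hres]; exact hp.1) (by rw [hres]; exact hp.2.2.2)
  have hFunr : ∀ w : HeightOneSpectrum (𝓞 T.F), residueChar T.F w ∉ ({2, 3, 5, l} : Finset ℕ) →
      finBelow P.F T.F w ∉ Cor22.badPlacesAvoid P {2, l} → w.asIdeal.ramificationIdx (𝓞 P.F) = 1 := by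
    intro w hp hSw
    simp only [Finset.mem_insert, Finset.mem_singleton, not_or] at hp
    refine hFgood w (by simp only [Finset.mem_insert, Finset.mem_singleton, not_or]; exact ⟨hp.1, hp.2.1, hp.2.2.1⟩)
      fun hb => hSw ?_
    have hres : residueChar P.F (finBelow P.F T.F w) = residueChar T.F w := residueChar_finBelow (F := P.F) w
    exact avoid_of_bad _ hb (by rw [hres]; exact hp.1) (by rw [hres]; exact hp.2.2.2)
  have hD0 : ∀ u : HeightOneSpectrum (𝓞 T.K), 2 ≤ u.asIdeal.ramificationIdx ℤ → ¬ residueChar T.K u ∣ 2 * 3 * 5 * l →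
      finBelow P.F T.F (finBelow T.F T.K u) ∈ Cor22.badPlacesAvoid P {2, l} ∨
        2 ≤ (finBelow P.F T.F (finBelow T.F T.K u)).asIdeal.ramificationIdx ℤ := by
    intro u hram hndvd
    rw [hfb u]
    exact ramified_place_descends_of_not_dvd P.F T.F T.K (Cor22.badPlacesAvoid P {2, l}) hKunr hFunr u hram hndvd
  have hB := T.sum_log_supportPrimes_le hP hl.pos hD0
  -- `C ≤ π(d*·l)`
  have hC : (((T.I.supportPrimes.filter (· ≤ 2 ^ 12 * 3 ^ 3 * 5 * Cor22.dmod P * l)).card : ℕ) : ℝ) ≤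
      (π (2 ^ 12 * 3 ^ 3 * 5 * Cor22.dmod P * l) : ℝ) := by
    exact_mod_cast Cor22.card_filter_le_primeCounting T.I.supportPrimes hprimes _
  -- tower arithmetic: `δ_explicit ≤ B_III(P, l)` by `deltaK_le_BIII_of_le21` (Steps (ii)(iii) = stepiii_final's arithmetic)
  have hδ := Cor22.deltaK_le_BIII_of_le21 (P := P) hl h5 hd le_rfl hA hB hC
  refine T.hullEstimateOf_mono h0 (le_trans (le_of_eq ?_) hδ)
  have e : (((2 ^ 12 * 3 ^ 3 * 5 * Cor22.dmod P : ℕ) : ℝ) * l) = ((2 : ℝ) ^ 12 * 3 ^ 3 * 5 * (Cor22.dmod P) * l) := by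
    push_cast; ring
  rw [hXl, e]

/-- **The `∀ T` form: `Cor22.HullVolumeAtDatum P l (B_III P l)` from S-a and the tower facts at every datum** — the
body of `stub_hullVolume` at an admissible `(P, l)` in the slot-constant regime, modulo the instance forms (α)–(γ).
[cite: Mochizuki2012, IUTchIV Thm. 1.10 proof Steps (ii)–(v) p. 24–29] [claim: Mochizuki2012, status: disputed] -/
theorem hullVolumeAtDatum_BIII_of_towerFacts (hP : P ∈ UP) (hl : l.Prime) (h7 : 7 ≤ l)
    (H : ∀ T : Cor22.ThetaVolumeDatumAt P l,
      letI := T.instFieldF; letI := T.instNumberFieldF; letI := T.instAlgebraF; letI := T.instFieldK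
      letI := T.instNumberFieldK; letI := T.instAlgebraK; letI := T.instFieldFbar; letI := T.instAlgebraFbar
      letI := T.instAlgebraKFbar; letI := T.instIsElliptic
      IsGalois P.F T.F ∧ IsGalois T.F T.K ∧ IsGalois (fieldOfModuli T.E) T.K ∧
      (∃ a : ℕ, a ≤ 14 ∧ Module.finrank P.F T.F ∣ 2 ^ a * 3 ^ 2 * 5) ∧
      Module.finrank T.F T.K ∣ l * (l - 1) ^ 2 * (l + 1) ∧
      (∀ u : HeightOneSpectrum (𝓞 T.K), residueChar T.K u ≠ l →
        finBelow P.F T.F (finBelow T.F T.K u) ∉ Cor22.badPlaces P → u.asIdeal.ramificationIdx (𝓞 T.F) = 1) ∧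
      (∀ u : HeightOneSpectrum (𝓞 T.K), residueChar T.K u ≠ l →
        finBelow P.F T.F (finBelow T.F T.K u) ∈ Cor22.badPlaces P →
          ¬ residueChar T.K u ∣ u.asIdeal.ramificationIdx (𝓞 T.F)) ∧
      (∀ w : HeightOneSpectrum (𝓞 T.F), residueChar T.F w ∉ ({2, 3, 5} : Finset ℕ) →
        finBelow P.F T.F w ∉ Cor22.badPlaces P → w.asIdeal.ramificationIdx (𝓞 P.F) = 1) ∧
      (∀ w : HeightOneSpectrum (𝓞 T.F), residueChar T.F w ∉ ({2, 3, 5} : Finset ℕ) →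
        ¬ residueChar T.F w ∣ w.asIdeal.ramificationIdx (𝓞 P.F)) ∧
      (∀ (p : ℕ) [hp : Fact p.Prime], p ∈ T.I.supportPrimes → ∀ v : placesOver (fieldOfModuli T.E) p,
        p - 2 < absRamificationIdx p ((T.I.σ.localFieldFamily p hp.out).k v) →
          p ≤ 2 ^ 12 * 3 ^ 3 * 5 * Cor22.dmod P * l ∧
            3 + Real.log (absRamificationIdx p ((T.I.σ.localFieldFamily p hp.out).k v)) ≤
              4 * Real.log (((2 ^ 12 * 3 ^ 3 * 5 * Cor22.dmod P : ℕ) : ℝ) * l)) ∧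
      (∀ p ∈ T.I.supportPrimes, ∀ v w : placesOver (fieldOfModuli T.E) p,
        (DHData.ofInput T.I).logQloc p v = (DHData.ofInput T.I).logQloc p w)) :
    Cor22.HullVolumeAtDatum P l (((l : ℝ) + 1) / 4 * ((1 + 12 * (Cor22.dmod P : ℝ) / l)
      * (P.logDiff + Cor22.logCondAvoid P {2, l}) + 2 * Real.log l + 52
        + 20 / 3 * Real.log (((2 ^ 12 * 3 ^ 3 * 5 * Cor22.dmod P : ℕ) : ℝ) * (l : ℝ))
          * (Nat.primeCounting (2 ^ 12 * 3 ^ 3 * 5 * Cor22.dmod P * l) : ℝ))) :=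
  fun T => hullEstimateOf_BIII_of_towerFacts T hP hl h7 (H T)

end PointDict

end Summit.ABC.IUTFork

end
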